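import Mathlib.NumberTheory.DirichletCharacter.Basic
import Mathlib.Data.ZMod.Units
import Literature.NumberTheory.LFunctions.DirichletCharacterCRT
import HarnessLib

/-!
# The primitive character inducing `χ θ̄` for characters `χ (mod a)`, `θ (mod b)`

Topic `Literature/NumberTheory/LFunctions`; namespace `Literature.NumberTheory.LFunctions`.
THEOREMS ONLY (no definition, no named fact). Companion of `DirichletCharacterPrimitiveProduct`
(coprime conductors) and of `Sieve.DrappeauDispersionCharacterCompletion.conductor_changeLevel_mul_inv_le`.

For Dirichlet characters `χ` to the modulus `a` and `θ` to the modulus `b` (no coprimality assumed)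
let `η = χθ̄` denote the character `changeLevel χ * (changeLevel θ)⁻¹` to the modulus `ab` and
`ξ = η.primitiveCharacter` the primitive character inducing it, to the modulus `cond η ∣ ab`
(Montgomery–Vaughan §9.1: every character is induced by a unique primitive one; Apostol Ch. 8).
We record the facts by which a twisted character sum `Σ_p χ(p)θ̄(p)c_p` over primes `p ∤ ab` is a
character sum of the PRIMITIVE character `ξ`:

* `changeLevel_mul_changeLevel_inv_apply_natCast`, `primitiveCharacter_mul_inv_apply_natCast`:
  `η(n) = ξ(n) = χ(n)θ̄(n)` for `(n, ab) = 1`;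
* `one_lt_conductor_mul_inv_of_ne`: `cond η > 1` as soon as `θ ≠ χ` (as characters mod `ab`);
* `changeLevel_primitiveCharacter_mul_inv_ne`: if `θ ≠ 1` then `ξ ≠ χ` as characters to the
  modulus `a · cond η` (so `ξ` is an admissible "`θ ≠ χ`" character for estimates stated for
  primitive characters distinct from `χ`, e.g. Zhang's Lemma 5.6);
* `changeLevel_primitiveCharacter_ne_of_not_dvd`: for `χ` primitive mod `a` and any `θ (mod m)`
  with `a ∤ m`, the primitive character `θ*` inducing `θ` is `≠ χ` (mod `a · cond θ`);
* `primitiveCharacter_inv_apply_natCast`: `(θ*)⁻¹(n) = θ̄(n)` for `(n, m) = 1`;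
* `one_lt_conductor_of_ne_one`: `cond θ > 1` for `θ ≠ 1`.

All statements are over an arbitrary `CommMonoidWithZero` of values. Deliberately NOT here: Gauss
sums of induced characters (`Sieve.MontgomeryVaughan1975GaussSums`), the coprime-moduli product
(`DirichletCharacterPrimitiveProduct`, `DirichletCharacterCRT`).

## References

* H. L. Montgomery, R. C. Vaughan, *Multiplicative Number Theory I*, CUP (2007), §9.1
  (primitive characters, induced modulus). [cite: MontgomeryVaughan2007, §9.1]
* T. M. Apostol, *Introduction to Analytic Number Theory*, Springer (1976), Ch. 8. [Apostol1976]
-/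

namespace Literature.NumberTheory.LFunctions

open DirichletCharacter

variable {R : Type*} [CommMonoidWithZero R] {a b : ℕ} [NeZero a] [NeZero b]

omit [NeZero a] [NeZero b] in
/-- **`(χθ̄)(k) = χ(k)θ̄(k)` for `(k, ab) = 1`** (integer argument): the product character
`changeLevel χ * (changeLevel θ)⁻¹ (mod ab)` agrees with `χ(k)θ⁻¹(k)` at integers prime to `ab`.
[cite: MontgomeryVaughan2007, §9.1] -/
theorem changeLevel_mul_changeLevel_inv_apply_intCast (χ : DirichletCharacter R a)
    (θ : DirichletCharacter R b) {k : ℤ} (hk : IsCoprime k ((a * b : ℕ) : ℤ)) :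
    (changeLevel (dvd_mul_right a b) χ * (changeLevel (dvd_mul_left b a) θ)⁻¹)
        ((k : ℤ) : ZMod (a * b)) = χ ((k : ℤ) : ZMod a) * θ⁻¹ ((k : ℤ) : ZMod b) := by
  rw [← map_inv, MulChar.mul_apply, changeLevel_eq_cast_of_dvd' χ _ hk,
    changeLevel_eq_cast_of_dvd' θ⁻¹ _ hk]

omit [NeZero a] [NeZero b] in
/-- **`(χθ̄)(n) = χ(n)θ̄(n)` for `(n, ab) = 1`** (natural-number argument).
[cite: MontgomeryVaughan2007, §9.1] -/
theorem changeLevel_mul_changeLevel_inv_apply_natCast (χ : DirichletCharacter R a)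
    (θ : DirichletCharacter R b) {n : ℕ} (hn : n.Coprime (a * b)) :
    (changeLevel (dvd_mul_right a b) χ * (changeLevel (dvd_mul_left b a) θ)⁻¹)
        (n : ZMod (a * b)) = χ (n : ZMod a) * θ⁻¹ (n : ZMod b) := by
  have h := changeLevel_mul_changeLevel_inv_apply_intCast χ θ (k := n)
    (Nat.isCoprime_iff_coprime.mpr hn)
  simpa only [Int.cast_natCast] using h

omit [NeZero a] [NeZero b] in
/-- **The primitive character `ξ` inducing `χθ̄ (mod ab)` takes the value `χ(n)θ̄(n)` at every `n`
prime to `ab`.** [cite: MontgomeryVaughan2007, §9.1] -/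
theorem primitiveCharacter_mul_inv_apply_natCast (χ : DirichletCharacter R a)
    (θ : DirichletCharacter R b) {n : ℕ} (hn : n.Coprime (a * b)) :
    (changeLevel (dvd_mul_right a b) χ * (changeLevel (dvd_mul_left b a) θ)⁻¹).primitiveCharacter
        (n : ZMod (changeLevel (dvd_mul_right a b) χ *
          (changeLevel (dvd_mul_left b a) θ)⁻¹).conductor) =
      χ (n : ZMod a) * θ⁻¹ (n : ZMod b) := by
  have hk : IsCoprime (n : ℤ) ((a * b : ℕ) : ℤ) := Nat.isCoprime_iff_coprime.mpr hn
  have h1 := primitiveCharacter_apply_of_isCoprime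
    (changeLevel (dvd_mul_right a b) χ * (changeLevel (dvd_mul_left b a) θ)⁻¹) hk
  rw [Int.cast_natCast, Int.cast_natCast] at h1
  rw [h1]
  exact changeLevel_mul_changeLevel_inv_apply_natCast χ θ hn

/-- **`cond(χθ̄) > 1` when `θ ≠ χ` (as characters to the modulus `ab`)**: the product character is
then non-principal. [cite: MontgomeryVaughan2007, §9.1] -/
theorem one_lt_conductor_mul_inv_of_ne (χ : DirichletCharacter R a) (θ : DirichletCharacter R b)
    (hne : changeLevel (dvd_mul_left b a) θ ≠ changeLevel (dvd_mul_right a b) χ) :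
    1 < (changeLevel (dvd_mul_right a b) χ * (changeLevel (dvd_mul_left b a) θ)⁻¹).conductor := by
  haveI : NeZero (a * b) := ⟨mul_ne_zero (NeZero.ne a) (NeZero.ne b)⟩
  have h0 : (changeLevel (dvd_mul_right a b) χ *
      (changeLevel (dvd_mul_left b a) θ)⁻¹).conductor ≠ 0 := conductor_ne_zero _
  have h1 : (changeLevel (dvd_mul_right a b) χ *
      (changeLevel (dvd_mul_left b a) θ)⁻¹).conductor ≠ 1 := by
    intro h
    have hη : changeLevel (dvd_mul_right a b) χ * (changeLevel (dvd_mul_left b a) θ)⁻¹ = 1 :=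
      eq_one_iff_conductor_eq_one.mpr h
    rw [mul_inv_eq_one] at hη
    exact hne hη.symm
  omega

/-- **`cond θ > 1` for a non-principal `θ`** (to a non-zero modulus). [cite: MontgomeryVaughan2007, §9.1] -/
theorem one_lt_conductor_of_ne_one {m : ℕ} [NeZero m] {θ : DirichletCharacter R m} (hθ : θ ≠ 1) :
    1 < θ.conductor := by
  have h0 : θ.conductor ≠ 0 := conductor_ne_zero θ
  have h1 : θ.conductor ≠ 1 := fun h => hθ (eq_one_iff_conductor_eq_one.mpr h)
  omega

omit [NeZero a] in
/-- A primitive character to a modulus `b > 1` is not principal. [cite: MontgomeryVaughan2007, §9.1] -/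
theorem ne_one_of_isPrimitive_of_one_lt {θ : DirichletCharacter R b} (hθ : θ.IsPrimitive)
    (hb : 1 < b) : θ ≠ 1 := by
  intro h
  rw [isPrimitive_def, h, conductor_one] at hθ
  omega

/-- **If `θ ≠ 1` then the primitive character `ξ` inducing `χθ̄` is not `χ`**, as characters to the
common modulus `a · cond(χθ̄)`. (If `ξ = χ` there, then `χ(n)θ̄(n) = η(n) = ξ(n) = χ(n)` at every unit
`n (mod ab)` — lift `n` to a unit modulo `ab · cond` to compare the two reductions — whence `θ̄ = 1`.)
This is the admissibility condition "`θ ≠ χ`" of character-sum estimates stated for primitive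
characters (e.g. Zhang 2022, Lemma 5.6) for the twisted character `χθ̄`.
[cite: MontgomeryVaughan2007, §9.1] -/
theorem changeLevel_primitiveCharacter_mul_inv_ne (χ : DirichletCharacter R a)
    (θ : DirichletCharacter R b) (hθ : θ ≠ 1) :
    changeLevel (dvd_mul_left _ a)
        (changeLevel (dvd_mul_right a b) χ * (changeLevel (dvd_mul_left b a) θ)⁻¹).primitiveCharacter ≠
      changeLevel (dvd_mul_right a _) χ := by
  haveI hab : NeZero (a * b) := ⟨mul_ne_zero (NeZero.ne a) (NeZero.ne b)⟩
  -- names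
  set η : DirichletCharacter R (a * b) :=
    changeLevel (dvd_mul_right a b) χ * (changeLevel (dvd_mul_left b a) θ)⁻¹ with hη
  set r := η.conductor with hr
  haveI hr0 : NeZero r := ⟨conductor_ne_zero η⟩
  haveI habr : NeZero (a * b * r) := ⟨mul_ne_zero (NeZero.ne (a * b)) (NeZero.ne r)⟩
  intro H
  apply hθ
  -- it suffices to show `θ⁻¹ = 1`
  suffices hinv : θ⁻¹ = 1 by rw [← inv_inv θ, hinv, inv_one]
  refine MulChar.ext fun u => ?_
  rw [MulChar.one_apply_coe]
  -- lift `u` to a unit `U (mod ab)` and further to `W (mod ab·r)`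
  obtain ⟨U, hU⟩ := ZMod.unitsMap_surjective (dvd_mul_left b a) u
  obtain ⟨W, hW⟩ := ZMod.unitsMap_surjective (dvd_mul_right (a * b) r) U
  have har : a * r ∣ a * b * r := ⟨b, by ring⟩
  have hrab : r ∣ a * b := conductor_dvd_level η
  set V : (ZMod (a * r))ˣ := ZMod.unitsMap har W with hV
  -- `η U = χ(U mod a) · θ⁻¹(U mod b)`
  have e1 : η (U : ZMod (a * b)) =
      χ (ZMod.cast (U : ZMod (a * b)) : ZMod a) * θ⁻¹ (ZMod.cast (U : ZMod (a * b)) : ZMod b) := by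
    rw [hη, ← map_inv, MulChar.mul_apply, changeLevel_eq_cast_of_dvd χ,
      changeLevel_eq_cast_of_dvd θ⁻¹]
  -- `η U = ξ(U mod r)`
  have e2 : η (U : ZMod (a * b)) =
      η.primitiveCharacter (ZMod.cast (U : ZMod (a * b)) : ZMod r) := by
    conv_lhs => rw [← changeLevel_primitiveCharacter η]
    rw [changeLevel_eq_cast_of_dvd]
  -- `ξ(V mod r) = χ(V mod a)` from `H`
  have e3 : η.primitiveCharacter (ZMod.cast (V : ZMod (a * r)) : ZMod r) =
      χ (ZMod.cast (V : ZMod (a * r)) : ZMod a) := by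
    have := congrArg (fun φ : DirichletCharacter R (a * r) => φ (V : ZMod (a * r))) H
    simpa only [changeLevel_eq_cast_of_dvd] using this
  -- the reductions of `U` and `V` agree (both come from `W`)
  have hUW : (U : ZMod (a * b)) = ZMod.cast (W : ZMod (a * b * r)) := by
    rw [← hW, ZMod.unitsMap_val]
  have hVW : (V : ZMod (a * r)) = ZMod.cast (W : ZMod (a * b * r)) := by
    rw [hV, ZMod.unitsMap_val]
  have cU_r : (ZMod.cast (U : ZMod (a * b)) : ZMod r) = ZMod.cast (W : ZMod (a * b * r)) := by
    rw [hUW, zmod_cast_cast (dvd_mul_right (a * b) r) hrab]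
  have cV_r : (ZMod.cast (V : ZMod (a * r)) : ZMod r) = ZMod.cast (W : ZMod (a * b * r)) := by
    rw [hVW, zmod_cast_cast har (dvd_mul_left r a)]
  have cU_a : (ZMod.cast (U : ZMod (a * b)) : ZMod a) = ZMod.cast (W : ZMod (a * b * r)) := by
    rw [hUW, zmod_cast_cast (dvd_mul_right (a * b) r) (dvd_mul_right a b)]
  have cV_a : (ZMod.cast (V : ZMod (a * r)) : ZMod a) = ZMod.cast (W : ZMod (a * b * r)) := by
    rw [hVW, zmod_cast_cast har (dvd_mul_right a r)]
  have cU_b : (ZMod.cast (U : ZMod (a * b)) : ZMod b) = (u : ZMod b) := by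
    rw [← hU, ZMod.unitsMap_val]
  -- assemble: `χ(U_a) θ⁻¹(u) = χ(U_a)`
  have key : χ (ZMod.cast (U : ZMod (a * b)) : ZMod a) * θ⁻¹ (u : ZMod b) =
      χ (ZMod.cast (U : ZMod (a * b)) : ZMod a) := by
    rw [← cU_b, ← e1, e2, cU_r, ← cV_r, e3, cV_a, ← cU_a]
  -- `χ(U_a)` is a unit: cancel it
  have hunit : IsUnit (χ (ZMod.cast (U : ZMod (a * b)) : ZMod a)) := by
    have : (ZMod.cast (U : ZMod (a * b)) : ZMod a) = ((ZMod.unitsMap (dvd_mul_right a b) U :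
        (ZMod a)ˣ) : ZMod a) := by rw [ZMod.unitsMap_val]
    rw [this]
    exact (Units.isUnit _).map χ
  calc θ⁻¹ (u : ZMod b) = 1 := by
        have h2 := key
        conv_rhs at h2 => rw [← mul_one (χ (ZMod.cast (U : ZMod (a * b)) : ZMod a))]
        exact hunit.mul_left_cancel h2

/-- **For `χ` primitive mod `a` and `θ (mod m)` with `a ∤ m`, the primitive character `θ*` inducing
`θ` is not `χ`** (as characters to the modulus `a · cond θ`): otherwise the conductors `cond θ = a`
would agree and `a = cond θ ∣ m`. (Zhang 2022 §14 p.79: "any non-principal character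
`θ (mod D₂k)` can not be induced by the real character `χ (mod D)`" when `D ∤ D₂k`.)
[cite: MontgomeryVaughan2007, §9.1] -/
theorem changeLevel_primitiveCharacter_ne_of_not_dvd {m : ℕ} [NeZero m] {χ : DirichletCharacter R a}
    (hχ : χ.IsPrimitive) (θ : DirichletCharacter R m) (ham : ¬ a ∣ m) :
    changeLevel (dvd_mul_left θ.conductor a) θ.primitiveCharacter ≠
      changeLevel (dvd_mul_right a θ.conductor) χ := by
  haveI : NeZero θ.conductor := ⟨conductor_ne_zero θ⟩
  haveI : NeZero (a * θ.conductor) := ⟨mul_ne_zero (NeZero.ne a) (NeZero.ne θ.conductor)⟩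
  intro H
  have h := congrArg conductor H
  rw [conductor_changeLevel, conductor_changeLevel,
    (isPrimitive_def _).mp (primitiveCharacter_isPrimitive θ), (isPrimitive_def _).mp hχ] at h
  exact ham (h ▸ conductor_dvd_level θ)

omit [NeZero a] [NeZero b] in
/-- **`(θ*)⁻¹(n) = θ̄(n)` for `(n, m) = 1`**: the inverse of the primitive character inducing `θ`
agrees with `θ⁻¹` at arguments prime to the modulus of `θ`. [cite: MontgomeryVaughan2007, §9.1] -/
theorem primitiveCharacter_inv_apply_natCast {m : ℕ} (θ : DirichletCharacter R m) {n : ℕ}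
    (hn : n.Coprime m) :
    (θ.primitiveCharacter)⁻¹ (n : ZMod θ.conductor) = θ⁻¹ (n : ZMod m) := by
  have hk : IsCoprime (n : ℤ) (m : ℤ) := Nat.isCoprime_iff_coprime.mpr hn
  have h1 := primitiveCharacter_apply_of_isCoprime θ hk
  rw [Int.cast_natCast, Int.cast_natCast] at h1
  rw [MulChar.inv_apply_eq_inv, MulChar.inv_apply_eq_inv, h1]

omit [NeZero a] [NeZero b] in
/-- **`θ*(n) = θ(n)` for `(n, m) = 1`** (natural-number argument; Mathlib's
`primitiveCharacter_apply_of_isCoprime` for integers). [cite: MontgomeryVaughan2007, §9.1] -/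
theorem primitiveCharacter_apply_natCast {m : ℕ} (θ : DirichletCharacter R m) {n : ℕ}
    (hn : n.Coprime m) :
    θ.primitiveCharacter (n : ZMod θ.conductor) = θ (n : ZMod m) := by
  have hk : IsCoprime (n : ℤ) (m : ℤ) := Nat.isCoprime_iff_coprime.mpr hn
  have h1 := primitiveCharacter_apply_of_isCoprime θ hk
  rwa [Int.cast_natCast, Int.cast_natCast] at h1

end Literature.NumberTheory.LFunctions
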